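import Summits.BirchSwinnertonDyer.Rank1Residual.X12.JZeroThreeDescent
import Summits.BirchSwinnertonDyer.Rank1Residual.X12.InertCoreInstancesA
import HarnessLib

/-!
# K12r@3 (`j = 0`, CM by `ℚ(√−3)`, `ord_{s=1} L(E,s) = 1`, `p = 3` RAMIFIED): per-class kernel records (A)
# — `243a1`, `432b1`, `576a1`, `675a1`, `900c1`, `972c1`, `972d1`, `1323a1`
# (cell `bsd-print-cfram`, seat p4; window `N < 2·10⁴` of the leaf `WAllCornerFRamifiedAtThree`)

HONEST FRAMING (cell `bsd-print-cfram`, run/shared/lean/pub/bsd-print-cfram/, D-0131 (2) print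
tier; verbatim in every file of the seat): the cell works the partition leaf
`CornerF ∧ p ramified in the CM field K` (LADDER-BSD row K7r = B13; W-ALL row 12r) in PARTITION
currency — a leaf or a cell counts only when its theorem is in the kernel BY NAME. NO class-wide
theorem for the `p = 3` slice is in print (bsd-wall-cm K12R3-SCOPING-v1 §3); these are PER-CLASS
records, one per isogeny class of the window `N < 2·10⁴` not already booked through a printed
family (Kriz–Li sextic twists / cube sums: 13 classes), in the booking shape of
`X12/JZeroThreeDescent.lean` (`JZeroThree.bsdp_three_of_noThreeTorsion`, seam
`X12.bsdp_of_sha_torsion_eq_zero` p220351). Definitions = Cremona's minimal models (data);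
theorems only otherwise; no named fact; nothing about any curve is ASSERTED — the per-class inputs
enter as hypotheses: `hr` (`ord_{s=1} L(E,s) ≤ 1`; Cremona: `= 1`), `h0` (`Ш(E/ℚ)[3] = 0`: the
CERTIFICATE), `hq`/`hv` (`#Ш_an(E) = q`, `ord₃ q = 0`; Cremona: `#Ш_an = 1` on every member of every
class below). beyond-print: NO (certificate assembly).

THE CERTIFICATE behind `h0` (two engines, two seats, two code bases; numbers quoted per record):
the `3`-isogeny descent along `φ : E_k → E_{−27k}` (`E_k : y² = x³ + k` the `j = 0` member,
kernel `⟨(0, ±√k)⟩`): `s_φ = dim_𝔽₃ Sel^φ(E_k)`, `s_φ̂ = dim_𝔽₃ Sel^φ̂(E_{−27k})`,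
`m = rank + [k ∈ ℚ²] + [−3k ∈ ℚ²]`, `EXCESS = s_φ + s_φ̂ − m = dim Ш(E_k)[φ] + dim Ш(E_{−27k})[φ̂]`;
EXCESS `0` ⟹ `Ш(E_k)[3] = 0 = Ш(E_{−27k})[3]`. Engine 1: x1b `x12sel3.gp` (Kummer images in
`K(S′,3)`, `bnfcertify`d, local images to the printed size [Schaefer 1996 L.3.8 = BES 2020 Prop. 27],
Cassels' Selmer-ratio identity and BES Prop. 28 checked on every edge), kit j101548 = j101531;
engine 2: sha-2 `iso3kum.gp` run by harvest-1, kit j103487 = j103505; the two engines agree on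
`(s_φ, s_φ̂)` on all 1838 members of the 919 classes `N < 5·10⁵` (x1b X12-ROUTE.md §17, harvest-1
GEN 25). `Ш(E)[3] = 0` is a `ℚ`-isogeny invariant inside these classes only through BSD — the record
states it for Cremona's curve 1 (= a `j = 0` member `E_k` up to `ℚ`-isomorphism, `k` quoted), on
which both engines computed it directly.

Per record: model (new, or REUSED by name with its instances), `IsElliptic`, `IsGloballyMinimal`
(Kraus–Silverman, kernel-decided), `j = 0`, the leaf cell `cornerF_three_<name>`, and
`bsdp_three_<name>` = `BSD(E, 3) ∧ #Ш(E/ℚ)[3^∞] = 1` under `hGZK`, `hr`, `h0`, `hq`, `hv`; the class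
form is `JZeroThree.bsdp_three_of_isIsogenous_of_noThreeTorsion` on the same hypotheses.

References: `X12/JZeroThreeDescent.lean`; `X12/MillerStollRecords.lean` §1; `X12/InertCoreInstancesA.lean`
§0 (record conventions); [cite: Cremona1997, Table 1]; [cite: Miller2011LMS, §1 and Def. 1.1];
[cite: SilvermanAEC2009, VII.1 Remark 1.1 and X.4]; x1b `gen13/sel3j0/SEL3J0-MEMBERS-1838.tsv`
(sha256 in that folder's SHA256SUMS).
-/

set_option autoImplicit false

noncomputable section

open scoped Classical

open WeierstrassCurve Literature.NumberTheory.EllipticCurves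
  Literature.NumberTheory.EllipticCurves.ModularForms
  Literature.NumberTheory.EllipticCurves.Rank1Residual
  Literature.NumberTheory.EllipticCurves.Rank1Residual.Typed
  Literature.NumberTheory.EllipticCurves.Rank1Residual.X11RankOneCertificates
  Summit.BirchSwinnertonDyer.BirchSwinnertonDyer.Rank1Residual.X11RankOne
  Summit.BirchSwinnertonDyer.Rank1Residual.X11b

namespace Summit.BirchSwinnertonDyer.Rank1Residual.X12

/-! ### `243a1 @ 3` (class `243a`, `N = 243 = 3⁵`) -/
namespace Records
/-- Cremona `243a1 = [0, 0, 1, 0, -1]`: `y² + y = x³ − 1` (`N = 243 = 3⁵`, `j = 0`, CM by `ℤ[ζ₃]`;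
`≅ E_k : y² = x³ + k` with `k = -48`; Cremona: rank `1`, `#E(ℚ)_tors = 1`, `∏ c_ℓ = 1`,
`#Ш_an = 1`). [cite: Cremona1997, Table 1 (curve 243a1)] -/
def c243a1 : WeierstrassCurve ℚ := ⟨0, 0, 1, 0, -1⟩

/-- `243a1` is an elliptic curve (`Δ = -243 ≠ 0`). [cite: SilvermanAEC2009, III.1] -/
instance isElliptic_c243a1 : c243a1.IsElliptic := by
  have h := isElliptic_of_discOf_ne_zero 0 0 1 0 (-1) (by decide)
  norm_num at h; exact h

set_option maxRecDepth 100000 in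
/-- `[0, 0, 1, 0, -1]` is globally minimal (`Δ = -243`; Kraus–Silverman criterion, kernel-decided).
[cite: SilvermanAEC2009, VII.1 Remark 1.1 and VIII.8] -/
instance isGloballyMinimal_c243a1 : c243a1.IsGloballyMinimal := by
  have h := isGloballyMinimal_of_krausCriterion_bounded 0 0 1 0 (-1)
    (by decide) (by decide) (by decide +kernel)
  norm_num at h; exact h

/-- `j(243a1) = 0` (`c₄ = 0`). [cite: Cremona1997, Table 1 (curve 243a1)] -/
theorem c243a1_j : c243a1.j = 0 := by
  have hc4 : c243a1.c₄ = 0 := by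
    norm_num [c243a1, WeierstrassCurve.c₄, WeierstrassCurve.b₂, WeierstrassCurve.b₄]
  rw [WeierstrassCurve.j, hc4]
  simp

end Records

/-- **`(243a1, 3)` is a cell of the leaf `CornerF ∧ CMRamified` at `3`** (CM by `ℚ(√−3)`,
`r_an = 1`, `3` bad and ramified), given `ord_{s=1} L(E,s) = 1` (`hr`; Cremona). [folklore] -/
theorem cornerF_three_c243a1 (hr : Records.c243a1.analyticRank = 1) : CornerF Records.c243a1 3 :=
  JZeroThree.cornerF_three_of_j_eq_zero _ Records.c243a1_j hr

/-- **`BSD(243a1, 3)` and `#Ш(243a1/ℚ)[3^∞] = 1`** from GZK (`hGZK`), `ord_{s=1} L(E,s) ≤ 1`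
(`hr`), the two-engine `3`-isogeny-descent certificate `Ш(E/ℚ)[3] = 0` (`h0`; 243a1: k = -48, (s_φ, s_φ̂, m, EXCESS) = (1, 1, 2, 0); 243a2: k = 1296, (s_φ, s_φ̂, m, EXCESS) = (1, 1, 2, 0);
engines x1b j101548 / sha-2 j103487, agreeing) and `#Ш_an = q`, `ord₃ q = 0` (`hq`, `hv`; Cremona
`#Ш_an`: 243a1 1, 243a2 1). PER CLASS; nothing asserted. [cite: Miller2011LMS, §1 and Def. 1.1]
[cite: Cremona1997, Table 1 (class 243a)] -/
theorem bsdp_three_c243a1 (hGZK : rank_eq_analyticRank_of_analyticRank_le_one)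
    (hr : Records.c243a1.analyticRank ≤ 1) (h0 : ∀ x : ↥Records.c243a1.sha, 3 • x = 0 → x = 0)
    {q : ℚ} (hq : shaAn Records.c243a1 = (q : ℂ)) (hv : padicValRat 3 q = 0) :
    BSDp Records.c243a1 3 ∧ Nat.card (AddCommGroup.primaryComponent Records.c243a1.sha 3) = 1 :=
  JZeroThree.bsdp_three_of_noThreeTorsion _ hGZK hr h0 hq hv

/-! ### `432b1 @ 3` (class `432b`, `N = 432 = 2⁴·3³`) -/
namespace Records
/-- Cremona `432b1 = [0, 0, 0, 0, -4]`: `y² = x³ − 4` (`N = 432 = 2⁴·3³`, `j = 0`, CM by `ℤ[ζ₃]`;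
`≅ E_k : y² = x³ + k` with `k = -4`; Cremona: rank `1`, `#E(ℚ)_tors = 1`, `∏ c_ℓ = 2`,
`#Ш_an = 1`). [cite: Cremona1997, Table 1 (curve 432b1)] -/
def c432b1 : WeierstrassCurve ℚ := ⟨0, 0, 0, 0, -4⟩

/-- `432b1` is an elliptic curve (`Δ = -6912 ≠ 0`). [cite: SilvermanAEC2009, III.1] -/
instance isElliptic_c432b1 : c432b1.IsElliptic := by
  have h := isElliptic_of_discOf_ne_zero 0 0 0 0 (-4) (by decide)
  norm_num at h; exact h

set_option maxRecDepth 100000 in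
/-- `[0, 0, 0, 0, -4]` is globally minimal (`Δ = -6912`; Kraus–Silverman criterion, kernel-decided).
[cite: SilvermanAEC2009, VII.1 Remark 1.1 and VIII.8] -/
instance isGloballyMinimal_c432b1 : c432b1.IsGloballyMinimal := by
  have h := isGloballyMinimal_of_krausCriterion_bounded 0 0 0 0 (-4)
    (by decide) (by decide) (by decide +kernel)
  norm_num at h; exact h

/-- `j(432b1) = 0` (`c₄ = 0`). [cite: Cremona1997, Table 1 (curve 432b1)] -/
theorem c432b1_j : c432b1.j = 0 := by
  have hc4 : c432b1.c₄ = 0 := by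
    norm_num [c432b1, WeierstrassCurve.c₄, WeierstrassCurve.b₂, WeierstrassCurve.b₄]
  rw [WeierstrassCurve.j, hc4]
  simp

end Records

/-- **`(432b1, 3)` is a cell of the leaf `CornerF ∧ CMRamified` at `3`** (CM by `ℚ(√−3)`,
`r_an = 1`, `3` bad and ramified), given `ord_{s=1} L(E,s) = 1` (`hr`; Cremona). [folklore] -/
theorem cornerF_three_c432b1 (hr : Records.c432b1.analyticRank = 1) : CornerF Records.c432b1 3 :=
  JZeroThree.cornerF_three_of_j_eq_zero _ Records.c432b1_j hr

/-- **`BSD(432b1, 3)` and `#Ш(432b1/ℚ)[3^∞] = 1`** from GZK (`hGZK`), `ord_{s=1} L(E,s) ≤ 1`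
(`hr`), the two-engine `3`-isogeny-descent certificate `Ш(E/ℚ)[3] = 0` (`h0`; 432b1: k = -4, (s_φ, s_φ̂, m, EXCESS) = (1, 0, 1, 0); 432b2: k = 108, (s_φ, s_φ̂, m, EXCESS) = (0, 1, 1, 0);
engines x1b j101548 / sha-2 j103487, agreeing) and `#Ш_an = q`, `ord₃ q = 0` (`hq`, `hv`; Cremona
`#Ш_an`: 432b1 1, 432b2 1). PER CLASS; nothing asserted. [cite: Miller2011LMS, §1 and Def. 1.1]
[cite: Cremona1997, Table 1 (class 432b)] -/
theorem bsdp_three_c432b1 (hGZK : rank_eq_analyticRank_of_analyticRank_le_one)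
    (hr : Records.c432b1.analyticRank ≤ 1) (h0 : ∀ x : ↥Records.c432b1.sha, 3 • x = 0 → x = 0)
    {q : ℚ} (hq : shaAn Records.c432b1 = (q : ℂ)) (hv : padicValRat 3 q = 0) :
    BSDp Records.c432b1 3 ∧ Nat.card (AddCommGroup.primaryComponent Records.c432b1.sha 3) = 1 :=
  JZeroThree.bsdp_three_of_noThreeTorsion _ hGZK hr h0 hq hv

/-! ### `576a1 @ 3` (class `576a`, `N = 576 = 2⁶·3²`) -/
namespace Records
/-- Cremona `576a1 = [0, 0, 0, 0, 8]`: `y² = x³ + 8` (`N = 576 = 2⁶·3²`, `j = 0`, CM by `ℤ[ζ₃]`;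
`≅ E_k : y² = x³ + k` with `k = 8`; Cremona: rank `1`, `#E(ℚ)_tors = 2`, `∏ c_ℓ = 4`,
`#Ш_an = 1`). [cite: Cremona1997, Table 1 (curve 576a1)] -/
def c576a1 : WeierstrassCurve ℚ := ⟨0, 0, 0, 0, 8⟩

/-- `576a1` is an elliptic curve (`Δ = -27648 ≠ 0`). [cite: SilvermanAEC2009, III.1] -/
instance isElliptic_c576a1 : c576a1.IsElliptic := by
  have h := isElliptic_of_discOf_ne_zero 0 0 0 0 8 (by decide)
  norm_num at h; exact h

set_option maxRecDepth 100000 in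
/-- `[0, 0, 0, 0, 8]` is globally minimal (`Δ = -27648`; Kraus–Silverman criterion, kernel-decided).
[cite: SilvermanAEC2009, VII.1 Remark 1.1 and VIII.8] -/
instance isGloballyMinimal_c576a1 : c576a1.IsGloballyMinimal := by
  have h := isGloballyMinimal_of_krausCriterion_bounded 0 0 0 0 8
    (by decide) (by decide) (by decide +kernel)
  norm_num at h; exact h

/-- `j(576a1) = 0` (`c₄ = 0`). [cite: Cremona1997, Table 1 (curve 576a1)] -/
theorem c576a1_j : c576a1.j = 0 := by
  have hc4 : c576a1.c₄ = 0 := by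
    norm_num [c576a1, WeierstrassCurve.c₄, WeierstrassCurve.b₂, WeierstrassCurve.b₄]
  rw [WeierstrassCurve.j, hc4]
  simp

end Records

/-- **`(576a1, 3)` is a cell of the leaf `CornerF ∧ CMRamified` at `3`** (CM by `ℚ(√−3)`,
`r_an = 1`, `3` bad and ramified), given `ord_{s=1} L(E,s) = 1` (`hr`; Cremona). [folklore] -/
theorem cornerF_three_c576a1 (hr : Records.c576a1.analyticRank = 1) : CornerF Records.c576a1 3 :=
  JZeroThree.cornerF_three_of_j_eq_zero _ Records.c576a1_j hr

/-- **`BSD(576a1, 3)` and `#Ш(576a1/ℚ)[3^∞] = 1`** from GZK (`hGZK`), `ord_{s=1} L(E,s) ≤ 1`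
(`hr`), the two-engine `3`-isogeny-descent certificate `Ш(E/ℚ)[3] = 0` (`h0`; 576a1: k = 8, (s_φ, s_φ̂, m, EXCESS) = (0, 1, 1, 0); 576a3: k = -216, (s_φ, s_φ̂, m, EXCESS) = (1, 0, 1, 0);
engines x1b j101548 / sha-2 j103487, agreeing) and `#Ш_an = q`, `ord₃ q = 0` (`hq`, `hv`; Cremona
`#Ш_an`: 576a1 1, 576a2 1, 576a3 1, 576a4 1). PER CLASS; nothing asserted. [cite: Miller2011LMS, §1 and Def. 1.1]
[cite: Cremona1997, Table 1 (class 576a)] -/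
theorem bsdp_three_c576a1 (hGZK : rank_eq_analyticRank_of_analyticRank_le_one)
    (hr : Records.c576a1.analyticRank ≤ 1) (h0 : ∀ x : ↥Records.c576a1.sha, 3 • x = 0 → x = 0)
    {q : ℚ} (hq : shaAn Records.c576a1 = (q : ℂ)) (hv : padicValRat 3 q = 0) :
    BSDp Records.c576a1 3 ∧ Nat.card (AddCommGroup.primaryComponent Records.c576a1.sha 3) = 1 :=
  JZeroThree.bsdp_three_of_noThreeTorsion _ hGZK hr h0 hq hv

/-! ### `675a1 @ 3` (class `675a`, `N = 675 = 3³·5²`) -/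
namespace Records
/-! Model `c675a1 = [0, 0, 1, 0, 31]` (`y² + y = x³ + 31`; `k = 2000`; Cremona: rank `1`, `#E(ℚ)_tors = 1`,
`∏ c_ℓ = 2`, `#Ш_an = 1`) with its `IsElliptic` / `IsGloballyMinimal` instances is REUSED from
`InertCoreInstancesA.lean`. -/

/-- `j(675a1) = 0` (`c₄ = 0`). [cite: Cremona1997, Table 1 (curve 675a1)] -/
theorem c675a1_j : c675a1.j = 0 := by
  have hc4 : c675a1.c₄ = 0 := by
    norm_num [c675a1, WeierstrassCurve.c₄, WeierstrassCurve.b₂, WeierstrassCurve.b₄]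
  rw [WeierstrassCurve.j, hc4]
  simp

end Records

/-- **`(675a1, 3)` is a cell of the leaf `CornerF ∧ CMRamified` at `3`** (CM by `ℚ(√−3)`,
`r_an = 1`, `3` bad and ramified), given `ord_{s=1} L(E,s) = 1` (`hr`; Cremona). [folklore] -/
theorem cornerF_three_c675a1 (hr : Records.c675a1.analyticRank = 1) : CornerF Records.c675a1 3 :=
  JZeroThree.cornerF_three_of_j_eq_zero _ Records.c675a1_j hr

/-- **`BSD(675a1, 3)` and `#Ш(675a1/ℚ)[3^∞] = 1`** from GZK (`hGZK`), `ord_{s=1} L(E,s) ≤ 1`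
(`hr`), the two-engine `3`-isogeny-descent certificate `Ш(E/ℚ)[3] = 0` (`h0`; 675a1: k = 2000, (s_φ, s_φ̂, m, EXCESS) = (0, 1, 1, 0); 675a2: k = -54000, (s_φ, s_φ̂, m, EXCESS) = (1, 0, 1, 0);
engines x1b j101548 / sha-2 j103487, agreeing) and `#Ш_an = q`, `ord₃ q = 0` (`hq`, `hv`; Cremona
`#Ш_an`: 675a1 1, 675a2 1, 675a3 1, 675a4 1). PER CLASS; nothing asserted. [cite: Miller2011LMS, §1 and Def. 1.1]
[cite: Cremona1997, Table 1 (class 675a)] -/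
theorem bsdp_three_c675a1 (hGZK : rank_eq_analyticRank_of_analyticRank_le_one)
    (hr : Records.c675a1.analyticRank ≤ 1) (h0 : ∀ x : ↥Records.c675a1.sha, 3 • x = 0 → x = 0)
    {q : ℚ} (hq : shaAn Records.c675a1 = (q : ℂ)) (hv : padicValRat 3 q = 0) :
    BSDp Records.c675a1 3 ∧ Nat.card (AddCommGroup.primaryComponent Records.c675a1.sha 3) = 1 :=
  JZeroThree.bsdp_three_of_noThreeTorsion _ hGZK hr h0 hq hv

/-! ### `900c1 @ 3` (class `900c`, `N = 900 = 2²·3²·5²`) -/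
namespace Records
/-! Model `c900c1 = [0, 0, 0, 0, 100]` (`y² = x³ + 100`; `k = 100`; Cremona: rank `1`, `#E(ℚ)_tors = 3`,
`∏ c_ℓ = 18`, `#Ш_an = 1`) with its `IsElliptic` / `IsGloballyMinimal` instances is REUSED from
`InertCoreInstancesA.lean`. -/

/-- `j(900c1) = 0` (`c₄ = 0`). [cite: Cremona1997, Table 1 (curve 900c1)] -/
theorem c900c1_j : c900c1.j = 0 := by
  have hc4 : c900c1.c₄ = 0 := by
    norm_num [c900c1, WeierstrassCurve.c₄, WeierstrassCurve.b₂, WeierstrassCurve.b₄]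
  rw [WeierstrassCurve.j, hc4]
  simp

end Records

/-- **`(900c1, 3)` is a cell of the leaf `CornerF ∧ CMRamified` at `3`** (CM by `ℚ(√−3)`,
`r_an = 1`, `3` bad and ramified), given `ord_{s=1} L(E,s) = 1` (`hr`; Cremona). [folklore] -/
theorem cornerF_three_c900c1 (hr : Records.c900c1.analyticRank = 1) : CornerF Records.c900c1 3 :=
  JZeroThree.cornerF_three_of_j_eq_zero _ Records.c900c1_j hr

/-- **`BSD(900c1, 3)` and `#Ш(900c1/ℚ)[3^∞] = 1`** from GZK (`hGZK`), `ord_{s=1} L(E,s) ≤ 1`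
(`hr`), the two-engine `3`-isogeny-descent certificate `Ш(E/ℚ)[3] = 0` (`h0`; 900c1: k = 100, (s_φ, s_φ̂, m, EXCESS) = (0, 2, 2, 0); 900c2: k = -2700, (s_φ, s_φ̂, m, EXCESS) = (2, 0, 2, 0);
engines x1b j101548 / sha-2 j103487, agreeing) and `#Ш_an = q`, `ord₃ q = 0` (`hq`, `hv`; Cremona
`#Ш_an`: 900c1 1, 900c2 1). PER CLASS; nothing asserted. [cite: Miller2011LMS, §1 and Def. 1.1]
[cite: Cremona1997, Table 1 (class 900c)] -/
theorem bsdp_three_c900c1 (hGZK : rank_eq_analyticRank_of_analyticRank_le_one)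
    (hr : Records.c900c1.analyticRank ≤ 1) (h0 : ∀ x : ↥Records.c900c1.sha, 3 • x = 0 → x = 0)
    {q : ℚ} (hq : shaAn Records.c900c1 = (q : ℂ)) (hv : padicValRat 3 q = 0) :
    BSDp Records.c900c1 3 ∧ Nat.card (AddCommGroup.primaryComponent Records.c900c1.sha 3) = 1 :=
  JZeroThree.bsdp_three_of_noThreeTorsion _ hGZK hr h0 hq hv

/-! ### `972c1 @ 3` (class `972c`, `N = 972 = 2²·3⁵`) -/
namespace Records
/-- Cremona `972c1 = [0, 0, 0, 0, 9]`: `y² = x³ + 9` (`N = 972 = 2²·3⁵`, `j = 0`, CM by `ℤ[ζ₃]`;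
`≅ E_k : y² = x³ + k` with `k = 9`; Cremona: rank `1`, `#E(ℚ)_tors = 3`, `∏ c_ℓ = 9`,
`#Ш_an = 1`). [cite: Cremona1997, Table 1 (curve 972c1)] -/
def c972c1 : WeierstrassCurve ℚ := ⟨0, 0, 0, 0, 9⟩

/-- `972c1` is an elliptic curve (`Δ = -34992 ≠ 0`). [cite: SilvermanAEC2009, III.1] -/
instance isElliptic_c972c1 : c972c1.IsElliptic := by
  have h := isElliptic_of_discOf_ne_zero 0 0 0 0 9 (by decide)
  norm_num at h; exact h

set_option maxRecDepth 100000 in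
/-- `[0, 0, 0, 0, 9]` is globally minimal (`Δ = -34992`; Kraus–Silverman criterion, kernel-decided).
[cite: SilvermanAEC2009, VII.1 Remark 1.1 and VIII.8] -/
instance isGloballyMinimal_c972c1 : c972c1.IsGloballyMinimal := by
  have h := isGloballyMinimal_of_krausCriterion_bounded 0 0 0 0 9
    (by decide) (by decide) (by decide +kernel)
  norm_num at h; exact h

/-- `j(972c1) = 0` (`c₄ = 0`). [cite: Cremona1997, Table 1 (curve 972c1)] -/
theorem c972c1_j : c972c1.j = 0 := by
  have hc4 : c972c1.c₄ = 0 := by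
    norm_num [c972c1, WeierstrassCurve.c₄, WeierstrassCurve.b₂, WeierstrassCurve.b₄]
  rw [WeierstrassCurve.j, hc4]
  simp

end Records

/-- **`(972c1, 3)` is a cell of the leaf `CornerF ∧ CMRamified` at `3`** (CM by `ℚ(√−3)`,
`r_an = 1`, `3` bad and ramified), given `ord_{s=1} L(E,s) = 1` (`hr`; Cremona). [folklore] -/
theorem cornerF_three_c972c1 (hr : Records.c972c1.analyticRank = 1) : CornerF Records.c972c1 3 :=
  JZeroThree.cornerF_three_of_j_eq_zero _ Records.c972c1_j hr

/-- **`BSD(972c1, 3)` and `#Ш(972c1/ℚ)[3^∞] = 1`** from GZK (`hGZK`), `ord_{s=1} L(E,s) ≤ 1`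
(`hr`), the two-engine `3`-isogeny-descent certificate `Ш(E/ℚ)[3] = 0` (`h0`; 972c1: k = 9, (s_φ, s_φ̂, m, EXCESS) = (0, 2, 2, 0); 972c2: k = -243, (s_φ, s_φ̂, m, EXCESS) = (2, 0, 2, 0);
engines x1b j101548 / sha-2 j103487, agreeing) and `#Ш_an = q`, `ord₃ q = 0` (`hq`, `hv`; Cremona
`#Ш_an`: 972c1 1, 972c2 1). PER CLASS; nothing asserted. [cite: Miller2011LMS, §1 and Def. 1.1]
[cite: Cremona1997, Table 1 (class 972c)] -/
theorem bsdp_three_c972c1 (hGZK : rank_eq_analyticRank_of_analyticRank_le_one)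
    (hr : Records.c972c1.analyticRank ≤ 1) (h0 : ∀ x : ↥Records.c972c1.sha, 3 • x = 0 → x = 0)
    {q : ℚ} (hq : shaAn Records.c972c1 = (q : ℂ)) (hv : padicValRat 3 q = 0) :
    BSDp Records.c972c1 3 ∧ Nat.card (AddCommGroup.primaryComponent Records.c972c1.sha 3) = 1 :=
  JZeroThree.bsdp_three_of_noThreeTorsion _ hGZK hr h0 hq hv

/-! ### `972d1 @ 3` (class `972d`, `N = 972 = 2²·3⁵`) -/
namespace Records
/-- Cremona `972d1 = [0, 0, 0, 0, 36]`: `y² = x³ + 36` (`N = 972 = 2²·3⁵`, `j = 0`, CM by `ℤ[ζ₃]`;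
`≅ E_k : y² = x³ + k` with `k = 36`; Cremona: rank `1`, `#E(ℚ)_tors = 3`, `∏ c_ℓ = 9`,
`#Ш_an = 1`). [cite: Cremona1997, Table 1 (curve 972d1)] -/
def c972d1 : WeierstrassCurve ℚ := ⟨0, 0, 0, 0, 36⟩

/-- `972d1` is an elliptic curve (`Δ = -559872 ≠ 0`). [cite: SilvermanAEC2009, III.1] -/
instance isElliptic_c972d1 : c972d1.IsElliptic := by
  have h := isElliptic_of_discOf_ne_zero 0 0 0 0 36 (by decide)
  norm_num at h; exact h

set_option maxRecDepth 100000 in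
/-- `[0, 0, 0, 0, 36]` is globally minimal (`Δ = -559872`; Kraus–Silverman criterion, kernel-decided).
[cite: SilvermanAEC2009, VII.1 Remark 1.1 and VIII.8] -/
instance isGloballyMinimal_c972d1 : c972d1.IsGloballyMinimal := by
  have h := isGloballyMinimal_of_krausCriterion_bounded 0 0 0 0 36
    (by decide) (by decide) (by decide +kernel)
  norm_num at h; exact h

/-- `j(972d1) = 0` (`c₄ = 0`). [cite: Cremona1997, Table 1 (curve 972d1)] -/
theorem c972d1_j : c972d1.j = 0 := by
  have hc4 : c972d1.c₄ = 0 := by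
    norm_num [c972d1, WeierstrassCurve.c₄, WeierstrassCurve.b₂, WeierstrassCurve.b₄]
  rw [WeierstrassCurve.j, hc4]
  simp

end Records

/-- **`(972d1, 3)` is a cell of the leaf `CornerF ∧ CMRamified` at `3`** (CM by `ℚ(√−3)`,
`r_an = 1`, `3` bad and ramified), given `ord_{s=1} L(E,s) = 1` (`hr`; Cremona). [folklore] -/
theorem cornerF_three_c972d1 (hr : Records.c972d1.analyticRank = 1) : CornerF Records.c972d1 3 :=
  JZeroThree.cornerF_three_of_j_eq_zero _ Records.c972d1_j hr

/-- **`BSD(972d1, 3)` and `#Ш(972d1/ℚ)[3^∞] = 1`** from GZK (`hGZK`), `ord_{s=1} L(E,s) ≤ 1`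
(`hr`), the two-engine `3`-isogeny-descent certificate `Ш(E/ℚ)[3] = 0` (`h0`; 972d1: k = 36, (s_φ, s_φ̂, m, EXCESS) = (0, 2, 2, 0); 972d2: k = -972, (s_φ, s_φ̂, m, EXCESS) = (2, 0, 2, 0);
engines x1b j101548 / sha-2 j103487, agreeing) and `#Ш_an = q`, `ord₃ q = 0` (`hq`, `hv`; Cremona
`#Ш_an`: 972d1 1, 972d2 1). PER CLASS; nothing asserted. [cite: Miller2011LMS, §1 and Def. 1.1]
[cite: Cremona1997, Table 1 (class 972d)] -/
theorem bsdp_three_c972d1 (hGZK : rank_eq_analyticRank_of_analyticRank_le_one)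
    (hr : Records.c972d1.analyticRank ≤ 1) (h0 : ∀ x : ↥Records.c972d1.sha, 3 • x = 0 → x = 0)
    {q : ℚ} (hq : shaAn Records.c972d1 = (q : ℂ)) (hv : padicValRat 3 q = 0) :
    BSDp Records.c972d1 3 ∧ Nat.card (AddCommGroup.primaryComponent Records.c972d1.sha 3) = 1 :=
  JZeroThree.bsdp_three_of_noThreeTorsion _ hGZK hr h0 hq hv

/-! ### `1323a1 @ 3` (class `1323a`, `N = 1323 = 3³·7²`) -/
namespace Records
/-- Cremona `1323a1 = [0, 0, 1, 0, 600]`: `y² + y = x³ + 600` (`N = 1323 = 3³·7²`, `j = 0`, CM by `ℤ[ζ₃]`;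
`≅ E_k : y² = x³ + k` with `k = 38416`; Cremona: rank `1`, `#E(ℚ)_tors = 3`, `∏ c_ℓ = 3`,
`#Ш_an = 1`). [cite: Cremona1997, Table 1 (curve 1323a1)] -/
def c1323a1 : WeierstrassCurve ℚ := ⟨0, 0, 1, 0, 600⟩

/-- `1323a1` is an elliptic curve (`Δ = -155649627 ≠ 0`). [cite: SilvermanAEC2009, III.1] -/
instance isElliptic_c1323a1 : c1323a1.IsElliptic := by
  have h := isElliptic_of_discOf_ne_zero 0 0 1 0 600 (by decide)
  norm_num at h; exact h

set_option maxRecDepth 100000 in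
/-- `[0, 0, 1, 0, 600]` is globally minimal (`Δ = -155649627`; Kraus–Silverman criterion, kernel-decided).
[cite: SilvermanAEC2009, VII.1 Remark 1.1 and VIII.8] -/
instance isGloballyMinimal_c1323a1 : c1323a1.IsGloballyMinimal := by
  have h := isGloballyMinimal_of_krausCriterion_bounded 0 0 1 0 600
    (by decide) (by decide) (by decide +kernel)
  norm_num at h; exact h

/-- `j(1323a1) = 0` (`c₄ = 0`). [cite: Cremona1997, Table 1 (curve 1323a1)] -/
theorem c1323a1_j : c1323a1.j = 0 := by
  have hc4 : c1323a1.c₄ = 0 := by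
    norm_num [c1323a1, WeierstrassCurve.c₄, WeierstrassCurve.b₂, WeierstrassCurve.b₄]
  rw [WeierstrassCurve.j, hc4]
  simp

end Records

/-- **`(1323a1, 3)` is a cell of the leaf `CornerF ∧ CMRamified` at `3`** (CM by `ℚ(√−3)`,
`r_an = 1`, `3` bad and ramified), given `ord_{s=1} L(E,s) = 1` (`hr`; Cremona). [folklore] -/
theorem cornerF_three_c1323a1 (hr : Records.c1323a1.analyticRank = 1) : CornerF Records.c1323a1 3 :=
  JZeroThree.cornerF_three_of_j_eq_zero _ Records.c1323a1_j hr

/-- **`BSD(1323a1, 3)` and `#Ш(1323a1/ℚ)[3^∞] = 1`** from GZK (`hGZK`), `ord_{s=1} L(E,s) ≤ 1`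
(`hr`), the two-engine `3`-isogeny-descent certificate `Ш(E/ℚ)[3] = 0` (`h0`; 1323a1: k = 38416, (s_φ, s_φ̂, m, EXCESS) = (1, 1, 2, 0); 1323a2: k = -1037232, (s_φ, s_φ̂, m, EXCESS) = (1, 1, 2, 0);
engines x1b j101548 / sha-2 j103487, agreeing) and `#Ш_an = q`, `ord₃ q = 0` (`hq`, `hv`; Cremona
`#Ш_an`: 1323a1 1, 1323a2 1). PER CLASS; nothing asserted. [cite: Miller2011LMS, §1 and Def. 1.1]
[cite: Cremona1997, Table 1 (class 1323a)] -/
theorem bsdp_three_c1323a1 (hGZK : rank_eq_analyticRank_of_analyticRank_le_one)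
    (hr : Records.c1323a1.analyticRank ≤ 1) (h0 : ∀ x : ↥Records.c1323a1.sha, 3 • x = 0 → x = 0)
    {q : ℚ} (hq : shaAn Records.c1323a1 = (q : ℂ)) (hv : padicValRat 3 q = 0) :
    BSDp Records.c1323a1 3 ∧ Nat.card (AddCommGroup.primaryComponent Records.c1323a1.sha 3) = 1 :=
  JZeroThree.bsdp_three_of_noThreeTorsion _ hGZK hr h0 hq hv


end Summit.BirchSwinnertonDyer.Rank1Residual.X12

end
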